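import Mathlib
import HarnessLib
import Summits.RiemannHypothesis.RiemannHypothesis.Theses.LindelofBridge

/-!
# Line `birth` — BC3 skeleton for the crux `HalaszTuranSparsity` (stmt-RiemannHypothesis-10800)

Route `LindelofBridge` (route-RiemannHypothesis-LindelofBridge, CONDITIONAL on the Lindelöf hypothesis),
crux (rank 2) `Summit.RiemannHypothesis.RiemannHypothesis.Theses.LindelofBridge.HalaszTuranSparsity`:
Halász–Turán 1969 — under the Lindelöf hypothesis (INLINED in the crux as
`∀ ε > 0, (fun t : ℝ => ζ(1/2 + t i)) =O[atTop] (· ^ ε)`, which is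
`Literature.NumberTheory.LFunctions.LindelofHypothesis` unfolded), `N(σ, T) = O_{σ,ε}(T^ε)` for every
`σ > 3/4`, `ε > 0` (`N = Literature.NumberTheory.LFunctions.zetaZeroCountRe`; Titchmarsh–Heath-Brown §9.28
(9.28.4); Ivić 1985 (1.138); Montgomery 1971 Thm 12.3).

STATUS NOTE (read before staffing this crux). The crux is ALREADY A THEOREM IN THE TREE: its body is the
named fact `Literature.NumberTheory.LFunctions.HalaszTuran1969_lindelofSparsity` with `LindelofHypothesis`
unfolded (defeq), and that fact is discharged by
`Literature.NumberTheory.LFunctions.HalaszTuran1969_lindelofSparsity_holds`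
(`Literature/NumberTheory/LFunctions/HalaszTuranDensityProofs.lean`, sorry-free, axioms
propext / Classical.choice / Quot.sound; a one-line candidate proof `Proof.lean` has been attached to the
item since 2026-08-15). A prover closes the item by landing
`Theorems/LindelofBridgeHalaszTuranSparsity.lean` importing that Proofs file. This file is the BC3
certificate the route re-audit asks for: it types the proof's OWN architecture (T-HB §9.28) as three named
stubs, each closable from the same tree files, and composes them into the crux BY NAME.

THE LINE = Montgomery zero detection + Halász's large-values lemma with the Lindelöf kernel bound, beyond 3/4.

* `stub_lindelofSupBound` — WHERE LH ENTERS, and only here: the Lindelöf hypothesis (an `O`-statement at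
  `+∞`) in SUP FORM on symmetric segments, `‖ζ(1/2+it)‖ ≤ C_η U^η` for `|t| ≤ 3U`, `U ≥ 1`, every `η > 0`
  (reflection `ζ(conj s) = conj ζ(s)` for `t < 0`, a crude bound `‖ζ(1/2+it)‖ ≤ 4(1+|t|)` on the initial
  segment). Tree model: `Literature.NumberTheory.LFunctions.HalaszTuranLH.exists_norm_zeta_half_le_abs_of_lindelof`.
* `stub_largeValuesUnderSup` — THE HEART (hardest stub): under such a sup bound, for `3/4 < σ < 1` and every
  `κ > 0`, a `1`-spaced set of zeros `ρ` (`Re ρ ≥ σ`, `U < Im ρ ≤ 2U`) has at most `C U^κ` elements once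
  `U ≥ U₀(σ, κ)`. Content: zero detection with mollifier length `X = ⌈U^δ⌉` (Class II is EMPTY for
  `Y = ⌈R⁴⌉` because the Class-II integral is `≤ S X · 2π/(σ-1/2)²`), the smoothed Halász–Montgomery kernel
  `G_Y(τ) = Σ_{n≤Y} (1-n/Y)² n^{-iτ}` moved to `Re w = 1/2` — `|G_Y(τ)| ≤ 2Y/|τ|³ + √Y (4S+10)` for
  `1 ≤ |τ| ≤ U`, the `R T^{1/2} ↦ R T^ε N^{1/2}` improvement of T-HB §9.28 — and Halász's duality lemma on
  dyadic blocks; the absorption `√M · M^{1+2κ_d-2σ} = M^{-θ}` holds exactly because `σ > 3/4` (T-HB §9.29: "the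
  Halász method is only useful for σ ≥ 3/4"). Tree model:
  `Literature.NumberTheory.LFunctions.HalaszTuranLH.wellSpaced_of_lindelof_halasz`, which uses LH ONLY through
  the sup bound of stub 1 (its single line `obtain ⟨C_L, hCL, hζL⟩ := exists_norm_zeta_half_le_abs_of_lindelof hLH hκL0`),
  so this stub is that theorem with the sup bound promoted to the hypothesis.
* `stub_countingLayer` — the unconditional COUNTING LAYER: an eventual `C U^κ` bound for `1`-spaced zero sets
  in dyadic windows `(U, 2U]` at abscissa `σ ≥ 1/2` gives `N(σ, T) = O(T^ε)` for every `ε > κ` (Jensen's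
  unit-window count `Σ_{|Im ρ-τ|≤1/2} m(ρ) ≪ log(|τ|+2)`, representatives by `⌊Im ρ⌋` and parity, dyadic
  summation, `log` absorbed by `T^{ε-κ}`). Tree model: `ZeroDensity.wellSpacedBound_of_eventually`,
  `ZeroDensity.count_dyadic_le` with `exists_sum_zetaZeroWindow_le`, `ZeroDensity.isBigO_of_dyadic`
  (the last 12 lines of `HalaszTuran1969_lindelofSparsity_holds`).

`halaszTuran_of_stubSigs` (sorry-free) composes the three SIGNATURES into the crux's statement — for
`σ ≥ 1` there are no zeros (`riemannZeta_ne_zero_of_one_le_re`, Mathlib), so the well-spaced bound fed to the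
counting layer is vacuous there; for `3/4 < σ < 1` it is stub 2 applied to the sup bound of stub 1, with
`κ = ε/2`. `HalaszTuranSparsity_of : HalaszTuranSparsity` is THE skeleton theorem: the crux BY NAME from the
three declared stubs (the file's only theorem whose conclusion head is the crux decl). `sorry` occurs ONLY
in the three `stub_*` theorems.

Imports: the route file only (cone: Mathlib, `ZetaZeros`, `RHWave0`) — deliberately NOT
`HalaszTuranDensityProofs`, so that the BC3 probes (seat folder `bc/bc3_probes.lean`: for each stub,
`stub → HalaszTuranSparsity` and `stub → Summit.RiemannHypothesis` by
`first | exact? | simpa | simpa [C] | (unfold C; simpa) | aesop`, all six FAIL) are meaningful.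

Disproof.lean for this crux: none exists (`ledger crux ls stmt-RiemannHypothesis-10800`: no workfiles,
2026-08-17) — no `_false_without_` obligation to honour; `ledger negatives --problem RiemannHypothesis`:
nothing about `N(σ,T)` or LH. All three stubs are TRUE (proved in kind in the tree), so none is refutable.
-/

-- `Summit.<Summit>.<Problem>`: for the single-conjunct summit the duplicate `RiemannHypothesis.RiemannHypothesis` is mandated.
set_option linter.dupNamespace false

noncomputable section

namespace Summit.RiemannHypothesis.RiemannHypothesis.Cruxes.HalaszTuranSparsity.Birth

open Summit.RiemannHypothesis.RiemannHypothesis.Theses.LindelofBridge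

/-! ## The three registered stubs -/

/-- **Stub 1 — the Lindelöf hypothesis in sup form on symmetric segments (where LH enters the line).**
Under LH (inlined exactly as in the crux): for every `η > 0` there is `C > 0` with
`‖ζ(1/2 + it)‖ ≤ C · U^η` whenever `|t| ≤ 3U`, `U ≥ 1`. Why plausibly true: it IS true — LH bounds
`t ≥ T₁(η)`, `ζ(1/2 - it) = conj ζ(1/2 + it)` handles `t < 0`, and `‖ζ(1/2+it)‖ ≤ 4(1+|t|)` (Titchmarsh
(2.12.2)) the initial segment. Size S–M. Leans on: `riemannZeta_conj` (Mathlib),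
`ZeroDensity.norm_zeta_half_line_le` (tree). Tree model (one `exact` after
`import Literature.NumberTheory.LFunctions.HalaszTuranDensityProofs`):
`HalaszTuranLH.exists_norm_zeta_half_le_abs_of_lindelof`. [cite: Titchmarsh1986, §13.1] -/
theorem stub_lindelofSupBound :
    (∀ ε : ℝ, 0 < ε → (fun t : ℝ => riemannZeta (1 / 2 + t * Complex.I)) =O[Filter.atTop] fun t : ℝ => t ^ ε) →
      ∀ η : ℝ, 0 < η → ∃ C : ℝ, 0 < C ∧ ∀ U : ℝ, 1 ≤ U → ∀ t : ℝ, |t| ≤ 3 * U →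
        ‖riemannZeta (1 / 2 + t * Complex.I)‖ ≤ C * U ^ η := by
  sorry

/-- **Stub 2 — Halász–Montgomery large values under a subpolynomial sup bound, beyond 3/4 (THE HEART).**
If `‖ζ(1/2+it)‖ ≤ C_η U^η` on `|t| ≤ 3U` for every `η > 0`, then for `3/4 < σ < 1` and every `κ > 0`
there are `U₀ ≥ 1`, `C ≥ 0` such that every `1`-spaced (in ordinate) finite set of zeros `ρ` of `ζ` with
`Re ρ ≥ σ`, `U < Im ρ ≤ 2U`, `U ≥ U₀`, has at most `C U^κ` elements. Why plausibly true: it is the content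
of Halász–Turán's theorem in Montgomery's form (T-HB §9.28 (9.28.3)–(9.28.4) with `R T^{1/2} ↦ R T^ε N^{1/2}`),
and the tree's `HalaszTuranLH.wellSpaced_of_lindelof_halasz` proves it using LH only via the sup bound.
Why it is the hard stub: Perron for the smoothed kernel moved across the pole of `ζ(iτ + w)`, the
Class-II vacuity for `Y = ⌈R⁴⌉`, Halász's duality inequality with Riesz weights, divisor bounds
`d(n) ≤ C_d n^{κ_d}`, and the absorption that needs `σ > 3/4`. Size L (≈ 1300 lines in the tree model).
Leans on (tree): `ZeroDensity.perZero_dichotomy`, `ZeroDetect.rieszSum_eq_integral`,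
`Literature.NumberTheory.Sieve.MatomakiRadziwillL11.weighted_halasz_montgomery`,
`ZeroDensity.exists_classOne_const`. [cite: Titchmarsh1986, §9.28 (9.28.3)–(9.28.4)]
[cite: HalaszTuran1969, Theorem 1 (p. 122)] -/
theorem stub_largeValuesUnderSup :
    (∀ η : ℝ, 0 < η → ∃ C : ℝ, 0 < C ∧ ∀ U : ℝ, 1 ≤ U → ∀ t : ℝ, |t| ≤ 3 * U →
        ‖riemannZeta (1 / 2 + t * Complex.I)‖ ≤ C * U ^ η) →
      ∀ σ : ℝ, 3 / 4 < σ → σ < 1 → ∀ κ : ℝ, 0 < κ →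
        ∃ U₀ C : ℝ, 1 ≤ U₀ ∧ 0 ≤ C ∧ ∀ U : ℝ, U₀ ≤ U → ∀ Z : Finset ℂ,
          (∀ ρ ∈ Z, riemannZeta ρ = 0 ∧ σ ≤ ρ.re ∧ U < ρ.im ∧ ρ.im ≤ 2 * U) →
          (∀ ρ ∈ Z, ∀ ρ' ∈ Z, ρ ≠ ρ' → 1 ≤ |ρ.im - ρ'.im|) →
          (Z.card : ℝ) ≤ C * U ^ κ := by
  sorry

/-- **Stub 3 — the counting layer (unconditional).** At an abscissa `σ ≥ 1/2`: if for some `κ > 0` the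
`1`-spaced zero sets in the dyadic windows `(U, 2U]` with `Re ρ ≥ σ` are eventually `≤ C U^κ`, then
`N(σ, T) = O(T^ε)` for every `ε > κ`. Why plausibly true: it IS true — pick one zero per unit ordinate
class (Jensen: a unit window at height `τ` carries `≪ log(|τ|+2)` zeros with multiplicity), split by the
parity of `⌊Im ρ⌋` to get `1`-spacing, so `N(σ,2U) - N(σ,U) ≤ 2 C U^κ · C_w log(2U+3)`; small `U` by the
trivial count; dyadic summation and `log T ≪ T^{ε-κ}`. Size M. Leans on (tree):
`ZeroDensity.wellSpacedBound_of_eventually`, `ZeroDensity.count_dyadic_le`,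
`Literature.NumberTheory.LFunctions.exists_sum_zetaZeroWindow_le`, `ZeroDensity.isBigO_of_dyadic`,
`isBigO_rpow_rpow_atTop_of_le`. [cite: Ivic1985, §11.2 (11.11)–(11.12)] -/
theorem stub_countingLayer :
    ∀ σ : ℝ, 1 / 2 ≤ σ → ∀ κ : ℝ, 0 < κ →
      (∃ U₀ C : ℝ, 1 ≤ U₀ ∧ 0 ≤ C ∧ ∀ U : ℝ, U₀ ≤ U → ∀ Z : Finset ℂ,
          (∀ ρ ∈ Z, riemannZeta ρ = 0 ∧ σ ≤ ρ.re ∧ U < ρ.im ∧ ρ.im ≤ 2 * U) →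
          (∀ ρ ∈ Z, ∀ ρ' ∈ Z, ρ ≠ ρ' → 1 ≤ |ρ.im - ρ'.im|) →
          (Z.card : ℝ) ≤ C * U ^ κ) →
      ∀ ε : ℝ, κ < ε →
        (fun T : ℝ => (Literature.NumberTheory.LFunctions.zetaZeroCountRe σ T : ℝ)) =O[Filter.atTop]
          fun T : ℝ => T ^ ε := by
  sorry

/-! ## Sorry-free composition -/

/-- **The composition, over the three stub SIGNATURES** (sorry-free): LH ⟹ (stub 1) the sup bound ⟹
(stub 2, `κ = ε/2`) eventual `U^{ε/2}` bounds for `1`-spaced zero sets beyond every `σ ∈ (3/4, 1)` ⟹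
(stub 3) `N(σ,T) = O(T^ε)`; for `σ ≥ 1` the well-spaced hypothesis of stub 3 holds vacuously because
`ζ(s) ≠ 0` on `Re s ≥ 1` (`riemannZeta_ne_zero_of_one_le_re`). The conclusion is the crux's statement
written out (so that this lemma is NOT a second theorem headed by the crux decl). [folklore] -/
theorem halaszTuran_of_stubSigs
    (h₁ : (∀ ε : ℝ, 0 < ε → (fun t : ℝ => riemannZeta (1 / 2 + t * Complex.I)) =O[Filter.atTop] fun t : ℝ => t ^ ε) →
      ∀ η : ℝ, 0 < η → ∃ C : ℝ, 0 < C ∧ ∀ U : ℝ, 1 ≤ U → ∀ t : ℝ, |t| ≤ 3 * U →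
        ‖riemannZeta (1 / 2 + t * Complex.I)‖ ≤ C * U ^ η)
    (h₂ : (∀ η : ℝ, 0 < η → ∃ C : ℝ, 0 < C ∧ ∀ U : ℝ, 1 ≤ U → ∀ t : ℝ, |t| ≤ 3 * U →
        ‖riemannZeta (1 / 2 + t * Complex.I)‖ ≤ C * U ^ η) →
      ∀ σ : ℝ, 3 / 4 < σ → σ < 1 → ∀ κ : ℝ, 0 < κ →
        ∃ U₀ C : ℝ, 1 ≤ U₀ ∧ 0 ≤ C ∧ ∀ U : ℝ, U₀ ≤ U → ∀ Z : Finset ℂ,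
          (∀ ρ ∈ Z, riemannZeta ρ = 0 ∧ σ ≤ ρ.re ∧ U < ρ.im ∧ ρ.im ≤ 2 * U) →
          (∀ ρ ∈ Z, ∀ ρ' ∈ Z, ρ ≠ ρ' → 1 ≤ |ρ.im - ρ'.im|) →
          (Z.card : ℝ) ≤ C * U ^ κ)
    (h₃ : ∀ σ : ℝ, 1 / 2 ≤ σ → ∀ κ : ℝ, 0 < κ →
      (∃ U₀ C : ℝ, 1 ≤ U₀ ∧ 0 ≤ C ∧ ∀ U : ℝ, U₀ ≤ U → ∀ Z : Finset ℂ,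
          (∀ ρ ∈ Z, riemannZeta ρ = 0 ∧ σ ≤ ρ.re ∧ U < ρ.im ∧ ρ.im ≤ 2 * U) →
          (∀ ρ ∈ Z, ∀ ρ' ∈ Z, ρ ≠ ρ' → 1 ≤ |ρ.im - ρ'.im|) →
          (Z.card : ℝ) ≤ C * U ^ κ) →
      ∀ ε : ℝ, κ < ε →
        (fun T : ℝ => (Literature.NumberTheory.LFunctions.zetaZeroCountRe σ T : ℝ)) =O[Filter.atTop]
          fun T : ℝ => T ^ ε) :
    (∀ ε : ℝ, 0 < ε → (fun t : ℝ => riemannZeta (1 / 2 + t * Complex.I)) =O[Filter.atTop] fun t : ℝ => t ^ ε) →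
      ∀ σ : ℝ, 3 / 4 < σ → ∀ ε : ℝ, 0 < ε →
        (fun T : ℝ => (Literature.NumberTheory.LFunctions.zetaZeroCountRe σ T : ℝ)) =O[Filter.atTop]
          fun T : ℝ => T ^ ε := by
  intro hLH σ hσ ε hε
  refine h₃ σ (by linarith) (ε / 2) (by linarith) ?_ ε (by linarith)
  rcases le_or_gt 1 σ with h1σ | hσ1
  · -- `σ ≥ 1`: no zeros of `ζ` with `Re ρ ≥ σ`, so every admissible `Z` is empty
    refine ⟨1, 0, le_rfl, le_rfl, fun U _ Z hZ _ => ?_⟩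
    have hZ0 : Z = ∅ := Finset.eq_empty_of_forall_notMem fun ρ hρ =>
      riemannZeta_ne_zero_of_one_le_re (le_trans h1σ (hZ ρ hρ).2.1) (hZ ρ hρ).1
    simp [hZ0]
  · -- `3/4 < σ < 1`: the heart, fed with the sup form of LH
    exact h₂ (h₁ hLH) σ hσ hσ1 (ε / 2) (by linarith)

/-! ## The skeleton theorem: the crux BY NAME from the three declared stubs -/

/-- **THE SKELETON THEOREM.** The crux
`Summit.RiemannHypothesis.RiemannHypothesis.Theses.LindelofBridge.HalaszTuranSparsity`, concluded BY NAME
from the three DECLARED stubs `stub_lindelofSupBound`, `stub_largeValuesUnderSup`, `stub_countingLayer`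
(the only `sorry`s of the file) through the sorry-free composition `halaszTuran_of_stubSigs` (the crux
unfolds to its conclusion by `rfl`). [folklore] -/
theorem HalaszTuranSparsity_of : HalaszTuranSparsity :=
  halaszTuran_of_stubSigs stub_lindelofSupBound stub_largeValuesUnderSup stub_countingLayer

end Summit.RiemannHypothesis.RiemannHypothesis.Cruxes.HalaszTuranSparsity.Birth

end
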